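import Summits.QuantumAdvantage.QuantumAdvantage.Theorems.CubicForrelationNearExactIsExactTenDigits

/-!
# Crux `CubicForrelation.NearExactIsExact` (stmt-QuantumAdvantage-14043) — the MIXED-DIGIT Walsh tower on 16 bits

Certificate seat `b2b-cforr-cert` (gen 3; rung `θ₁₆ ≤ 31/32`).  HONEST FRAMING: a theorem about cubic Boolean functions on
16 bits — a finite-slice verdict toward the `θ_n` ladder, NOT summit progress.

For a CUBIC `g : 𝔽₂¹⁶ → 𝔽₂` every Walsh value is a multiple of `64 = 2^{⌈16/3⌉}` (Ax/McEliece, the landed `tw_base`):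
`W_g = 64·u`.  Writing the Euclidean binary digits `d₀ = u mod 2`, `d₁ = ⌊u/2⌋ mod 2`, `d₂ = ⌊u/4⌋ mod 2`, the Boolean
functions `d₀, d₁, d₂` have algebraic degree `≤ 1, ≤ 2, ≤ 4` respectively (`sx_digitZero`, `sx_digitOne`, `sx_digitTwo`),
with no hypothesis on the lower digits.  This is the landed `n = 10` mixed-digit lemma (`td_digitOne`, `td_digitTwo`) moved
six bits up: the cube-sum exponents `|I| + ⌈(16 − |I|)/3⌉ − 6` coincide with `|I| + ⌈(10 − |I|)/3⌉ − 4`, so the proofs are the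
same (Poisson over `E_I` + Ax on `E_{Iᶜ}` give `Σ_{E_I} u ≡ 0 (mod 4)` for `|I| ≥ 3` and `(mod 8)` for `|I| ≥ 5`; Ax again for
the lower digits; Möbius).  Numerical sanity check (seat folder `work/c/check16.c`): on random cubics the three degrees are
`≤ 1, 2, 4` and all three bounds are attained.

References: J. Ax, Amer. J. Math. 86 (1964); R. J. McEliece, Discrete Math. 3 (1972); C. Carlet, *Boolean Functions for
Cryptography and Coding Theory*, CUP 2021, §2.2 and §4.1.  Everything below is proved from Mathlib and the tree; axioms are
the standard three.
-/

set_option linter.dupNamespace false -- D-0017: single-problem summit ⇒ `QuantumAdvantage.QuantumAdvantage` by design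

noncomputable section

namespace Summit.QuantumAdvantage.QuantumAdvantage.Theorems.CubicForrelation.NearExactIsExact

open Finset
open Literature.Computability.QuantumComplexity
open Literature.Computability.QuantumComplexity.DerivativeWalsh (W)

/-! ### Cube sums at level 6 -/

/-- The cube sums of `u = W_g/64` for a cubic `g` on 16 bits: `64·Σ_{E_I} u = 2^{|I|}·2^{⌈(16−|I|)/3⌉}·z` (Poisson over
`E_I`, Ax on `E_{Iᶜ}`). [cite: Carlet2020, §4.1] -/
theorem sx_cube_sum (g : (Fin (8 + 8) → Bool) → Bool) (u : (Fin (8 + 8) → Bool) → ℤ) (hg : IsDegLeFun 3 g)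
    (hu : ∀ x, W (fun y => signOf (g y)) x = (2 : ℝ) ^ 6 * (u x : ℝ)) (I : Finset (Fin (8 + 8))) :
    ∃ z : ℤ, (2 : ℤ) ^ 6 * ∑ x ∈ {x : Fin (8 + 8) → Bool | ∀ i, x i = true → i ∈ I}, u x =
      2 ^ #I * (2 ^ ((8 + 8 - #I + 2) / 3) * z) := by
  have hP := bb_poisson (fun y => signOf (g y)) I
  obtain ⟨z, hz⟩ := stub_axParity (8 + 8) 3 g Iᶜ (by norm_num) hg
  have hj : #Iᶜ = 8 + 8 - #I := by rw [card_compl, Fintype.card_fin]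
  rw [hj, show (8 + 8 - #I + 3 - 1) / 3 = (8 + 8 - #I + 2) / 3 by omega] at hz
  rw [sum_congr rfl fun x _ => hu x, ← mul_sum, hz] at hP
  refine ⟨z, ?_⟩
  have h' : (((2 : ℤ) ^ 6 * ∑ x ∈ {x : Fin (8 + 8) → Bool | ∀ i, x i = true → i ∈ I}, u x : ℤ) : ℝ) =
      (((2 : ℤ) ^ #I * (2 ^ ((8 + 8 - #I + 2) / 3) * z) : ℤ) : ℝ) := by
    push_cast at hP ⊢
    linarith
  exact_mod_cast h'

/-- Divisibility read-out at a general level `a`: if `2^a·S = 2^i·(2^c·z)` and `a + e ≤ i + c` then `2^e ∣ S`. [folklore] -/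
theorem sx_dvd_of_balance {a i c e : ℕ} {S z : ℤ} (hle : a + e ≤ i + c)
    (h : (2 : ℤ) ^ a * S = 2 ^ i * (2 ^ c * z)) : (2 : ℤ) ^ e ∣ S := by
  obtain ⟨r, hr⟩ : ∃ r, i + c = a + e + r := ⟨i + c - (a + e), by omega⟩
  refine ⟨2 ^ r * z, ?_⟩
  have h0 : (2 : ℤ) ^ a ≠ 0 := by positivity
  apply mul_left_cancel₀ h0
  rw [h, ← mul_assoc, ← pow_add, hr, pow_add, pow_add]
  ring

/-! ### The three mixed digits on 16 bits -/

/-- **Digit zero.** For cubic `g` on 16 bits with `W_g = 64·u`, the parity `x ↦ [u(x) odd]` is AFFINE (degree `≤ 1`):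
the level-6 step of the landed tower `stub_walshTower`. [this work; cite: Carlet2020, §4.1 (McEliece)] -/
theorem sx_digitZero (g : (Fin (8 + 8) → Bool) → Bool) (u : (Fin (8 + 8) → Bool) → ℤ) (hg : IsDegLeFun 3 g)
    (hu : ∀ x, W (fun y => signOf (g y)) x = (2 : ℝ) ^ 6 * (u x : ℝ)) :
    IsDegLeFun 1 (fun x => decide (Odd (u x))) :=
  stub_walshTower stub_axParity (8 + 8) 6 1 g u hg hu (by intro k hk hkn; omega)

/-- **Digit one.** For cubic `g` on 16 bits with `W_g = 64·u`, the Boolean function `x ↦ [⌊u(x)/2⌋ odd]` (the second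
Euclidean binary digit of `u`, with NO assumption on the first) has algebraic degree `≤ 2`. [this work; cite: Carlet2020,
§4.1 (McEliece) for the divisibility input] -/
theorem sx_digitOne (g : (Fin (8 + 8) → Bool) → Bool) (u : (Fin (8 + 8) → Bool) → ℤ) (hg : IsDegLeFun 3 g)
    (hu : ∀ x, W (fun y => signOf (g y)) x = (2 : ℝ) ^ 6 * (u x : ℝ)) :
    IsDegLeFun 2 (fun x => decide (Odd (u x / 2))) := by
  have hP0 : IsDegLeFun 1 (fun x => decide (Odd (u x))) := sx_digitZero g u hg hu
  refine bb_moebius_isDegLeFun 2 _ fun I hI => ?_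
  have hk : #I ≤ 8 + 8 := (card_le_univ I).trans_eq (Fintype.card_fin _)
  -- the cube sum of `u` is divisible by 4
  obtain ⟨z, hz⟩ := sx_cube_sum g u hg hu I
  have h4 : (2 : ℤ) ^ 2 ∣ ∑ x ∈ {x : Fin (8 + 8) → Bool | ∀ i, x i = true → i ∈ I}, u x :=
    sx_dvd_of_balance (by omega) hz
  -- the number of odd `u` on the cube is divisible by 4
  obtain ⟨z', hz'⟩ := td_count_cube (le_refl 1) (fun x => decide (Odd (u x))) hP0 I
  rw [show (#I + 1 - 1) / 1 = #I by simp] at hz'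
  have hA : (4 : ℤ) ∣ #{x : Fin (8 + 8) → Bool | (∀ i, x i = true → i ∈ I) ∧ decide (Odd (u x)) = true} := by
    obtain ⟨e, he⟩ : ∃ e, #I = e + 3 := ⟨#I - 3, by omega⟩
    rw [he, show (2 : ℤ) ^ (e + 3) = 2 ^ e * 8 by rw [pow_add]; norm_num] at hz'
    refine ⟨2 ^ e * (1 - z'), ?_⟩
    linarith
  -- split `u = 2⌊u/2⌋ + [u odd]` under the sum
  have hsplit : ∑ x ∈ {x : Fin (8 + 8) → Bool | ∀ i, x i = true → i ∈ I}, u x =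
      2 * ∑ x ∈ {x : Fin (8 + 8) → Bool | ∀ i, x i = true → i ∈ I}, u x / 2 +
        #{x : Fin (8 + 8) → Bool | (∀ i, x i = true → i ∈ I) ∧ decide (Odd (u x)) = true} := by
    rw [sum_congr rfl fun x _ => td_two_mul_div_add (u x), sum_add_distrib, ← mul_sum, td_sum_ite_odd, filter_filter]
    simp only [decide_eq_true_eq]
  have hE : Even (∑ x ∈ {x : Fin (8 + 8) → Bool | ∀ i, x i = true → i ∈ I}, u x / 2) := by
    rw [pow_two] at h4
    obtain ⟨q, hq⟩ := h4
    obtain ⟨a, ha⟩ := hA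
    refine ⟨q - a, ?_⟩
    linarith
  have hE' := (tw_even_sum_iff _ (fun x => u x / 2)).1 hE
  rw [filter_filter] at hE'
  simpa only [decide_eq_true_eq] using hE'

/-- **Digit two.** For cubic `g` on 16 bits with `W_g = 64·u`, the Boolean function `x ↦ [⌊⌊u(x)/2⌋/2⌋ odd]` (the third
Euclidean binary digit of `u`) has algebraic degree `≤ 4`. [this work; cite: Carlet2020, §4.1 (McEliece) for the
divisibility input] -/
theorem sx_digitTwo (g : (Fin (8 + 8) → Bool) → Bool) (u : (Fin (8 + 8) → Bool) → ℤ) (hg : IsDegLeFun 3 g)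
    (hu : ∀ x, W (fun y => signOf (g y)) x = (2 : ℝ) ^ 6 * (u x : ℝ)) :
    IsDegLeFun 4 (fun x => decide (Odd (u x / 2 / 2))) := by
  have hP0 : IsDegLeFun 1 (fun x => decide (Odd (u x))) := sx_digitZero g u hg hu
  have hP1 := sx_digitOne g u hg hu
  refine bb_moebius_isDegLeFun 4 _ fun I hI => ?_
  have hk : #I ≤ 8 + 8 := (card_le_univ I).trans_eq (Fintype.card_fin _)
  obtain ⟨z, hz⟩ := sx_cube_sum g u hg hu I
  have h8 : (2 : ℤ) ^ 3 ∣ ∑ x ∈ {x : Fin (8 + 8) → Bool | ∀ i, x i = true → i ∈ I}, u x :=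
    sx_dvd_of_balance (by omega) hz
  -- `#{u odd on E_I} ≡ 0 (mod 8)`
  obtain ⟨z', hz'⟩ := td_count_cube (le_refl 1) (fun x => decide (Odd (u x))) hP0 I
  rw [show (#I + 1 - 1) / 1 = #I by simp] at hz'
  have hA : (8 : ℤ) ∣ #{x : Fin (8 + 8) → Bool | (∀ i, x i = true → i ∈ I) ∧ decide (Odd (u x)) = true} := by
    obtain ⟨e, he⟩ : ∃ e, #I = e + 4 := ⟨#I - 4, by omega⟩
    rw [he, show (2 : ℤ) ^ (e + 4) = 2 ^ e * 16 by rw [pow_add]; norm_num] at hz'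
    refine ⟨2 ^ e * (1 - z'), ?_⟩
    linarith
  -- `#{⌊u/2⌋ odd on E_I} ≡ 0 (mod 4)`
  obtain ⟨z'', hz''⟩ := td_count_cube (by norm_num : 1 ≤ 2) (fun x => decide (Odd (u x / 2))) hP1 I
  have hB : (4 : ℤ) ∣ #{x : Fin (8 + 8) → Bool | (∀ i, x i = true → i ∈ I) ∧ decide (Odd (u x / 2)) = true} := by
    obtain ⟨e, he⟩ : ∃ e, #I = e + 5 := ⟨#I - 5, by omega⟩
    obtain ⟨e', he'⟩ : ∃ e', (#I + 2 - 1) / 2 = e' + 3 := ⟨(#I + 2 - 1) / 2 - 3, by omega⟩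
    rw [he', he, show (2 : ℤ) ^ (e + 5) = 2 ^ e * 32 by rw [pow_add]; norm_num,
      show (2 : ℤ) ^ (e' + 3) = 2 ^ e' * 8 by rw [pow_add]; norm_num] at hz''
    refine ⟨2 ^ e * 4 - 2 ^ e' * z'', ?_⟩
    linarith
  have hsplit : ∑ x ∈ {x : Fin (8 + 8) → Bool | ∀ i, x i = true → i ∈ I}, u x =
      2 * (2 * ∑ x ∈ {x : Fin (8 + 8) → Bool | ∀ i, x i = true → i ∈ I}, u x / 2 / 2 +
        #{x : Fin (8 + 8) → Bool | (∀ i, x i = true → i ∈ I) ∧ decide (Odd (u x / 2)) = true}) +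
        #{x : Fin (8 + 8) → Bool | (∀ i, x i = true → i ∈ I) ∧ decide (Odd (u x)) = true} := by
    rw [sum_congr rfl fun x _ => td_two_mul_div_add (u x), sum_add_distrib, ← mul_sum, td_sum_ite_odd, filter_filter,
      sum_congr rfl fun x _ => td_two_mul_div_add (u x / 2), sum_add_distrib, ← mul_sum, td_sum_ite_odd, filter_filter]
    simp only [decide_eq_true_eq]
  have hE : Even (∑ x ∈ {x : Fin (8 + 8) → Bool | ∀ i, x i = true → i ∈ I}, u x / 2 / 2) := by
    obtain ⟨q, hq⟩ := h8
    obtain ⟨a, ha⟩ := hA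
    obtain ⟨b, hb⟩ := hB
    refine ⟨q - a - b, ?_⟩
    have := hsplit
    rw [hq, ha, hb] at this
    linarith
  have hE' := (tw_even_sum_iff _ (fun x => u x / 2 / 2)).1 hE
  rw [filter_filter] at hE'
  simpa only [decide_eq_true_eq] using hE'

/-! ### Parseval at level 6 and the size of the odd set -/

/-- Parseval at level 6: `W_g = 64u ⇒ Σ_x u(x)² = 2^{20}` (`Σ_x W_g(x)² = 2^{16}·2^{16}`). [folklore] -/
theorem sx_sum_u_sq (g : (Fin (8 + 8) → Bool) → Bool) (u : (Fin (8 + 8) → Bool) → ℤ)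
    (hu : ∀ x, W (fun y => signOf (g y)) x = (2 : ℝ) ^ 6 * (u x : ℝ)) :
    ∑ x, u x ^ 2 = 2 ^ 20 := by
  have hP := DerivativeWalsh.sum_W_sq (fun y => signOf (g y))
  have h1 : ∀ b : Bool, signOf b ^ 2 = (1 : ℝ) := fun b => by unfold signOf; split_ifs <;> norm_num
  have hL : ∑ x, W (fun y => signOf (g y)) x ^ 2 = (2 : ℝ) ^ 12 * ∑ x, (u x : ℝ) ^ 2 := by
    rw [mul_sum]
    exact sum_congr rfl fun x _ => by rw [hu x]; ring
  rw [hL, sum_congr rfl fun y _ => h1 _, sum_const, card_univ, Fintype.card_fun, Fintype.card_bool,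
    Fintype.card_fin] at hP
  norm_num at hP
  have h2 : ∑ x, (u x : ℝ) ^ 2 = 2 ^ 20 := by linarith
  exact_mod_cast h2

/-- **A non-constant affine parity is balanced.** If the level-6 parity `[u odd]` of a cubic `g` on 16 bits takes both
values, then exactly `2^{15}` of the `u(x)` are odd (Ax with `d = 1` on the full cube: `2·#odd = 2^{16} − 2^{16} z`, and
`0 < #odd < 2^{16}` forces `z = 0`). [this work] -/
theorem sx_card_odd_of_split (g : (Fin (8 + 8) → Bool) → Bool) (u : (Fin (8 + 8) → Bool) → ℤ) (hg : IsDegLeFun 3 g)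
    (hu : ∀ x, W (fun y => signOf (g y)) x = (2 : ℝ) ^ 6 * (u x : ℝ))
    (hodd : ∃ x, Odd (u x)) (heven : ∃ x, ¬ Odd (u x)) :
    #(univ.filter fun x : Fin (8 + 8) → Bool => Odd (u x)) = 2 ^ 15 := by
  obtain ⟨z, hz⟩ := td_count_cube (le_refl 1) (fun x => decide (Odd (u x))) (sx_digitZero g u hg hu) univ
  rw [card_univ, Fintype.card_fin, show (8 + 8 + 1 - 1) / 1 = 16 by norm_num] at hz
  have hset : ({x : Fin (8 + 8) → Bool | (∀ i, x i = true → i ∈ (univ : Finset (Fin (8 + 8)))) ∧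
      decide (Odd (u x)) = true} : Finset _) = univ.filter fun x => Odd (u x) := by
    ext x
    simp
  rw [hset] at hz
  set A := #(univ.filter fun x : Fin (8 + 8) → Bool => Odd (u x)) with hA
  have hApos : 0 < A := by
    obtain ⟨x₀, hx₀⟩ := hodd
    exact card_pos.2 ⟨x₀, by simp [hx₀]⟩
  have hAlt : A < 2 ^ 16 := by
    obtain ⟨x₁, hx₁⟩ := heven
    calc A < #(univ : Finset (Fin (8 + 8) → Bool)) := by
          apply card_lt_card
          exact (ssubset_iff_of_subset (filter_subset _ _)).2 ⟨x₁, mem_univ _, by simp [hx₁]⟩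
      _ = 2 ^ 16 := by rw [card_univ, Fintype.card_fun, Fintype.card_bool, Fintype.card_fin]
  norm_num at hz
  have hA' : (A : ℤ) < 2 ^ 16 := by exact_mod_cast hAlt
  have hA'' : (0 : ℤ) < A := by exact_mod_cast hApos
  have hz0 : z = 0 := by
    rcases lt_trichotomy z 0 with h | h | h
    · nlinarith
    · exact h
    · nlinarith
  rw [hz0, mul_zero, sub_zero] at hz
  have : (A : ℤ) = 2 ^ 15 := by linarith
  exact_mod_cast this

end Summit.QuantumAdvantage.QuantumAdvantage.Theorems.CubicForrelation.NearExactIsExact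

end
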